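import Literature.AnabelianGeometry.SemiGraphs.TemperedCompactFixedSystemsNearest
import Literature.AnabelianGeometry.SemiGraphs.TreeSystemFixedPointTopological
import Literature.AnabelianGeometry.SemiGraphs.TemperedCompactPreimage
import Literature.AnabelianGeometry.SemiGraphs.FreeGroupsAndActionsProofs
import Mathlib.Topology.Baire.Lemmas
import Mathlib.Topology.Baire.LocallyCompactRegular
import HarnessLib

/-!
# Compatible fixed systems from POINTWISE bounded displacement: Baire on the compact subgroup
# ([SemiAnbd] Thm 3.7 (iii), p. 41)

Mochizuki, *Semi-graphs of anabelioids*, Publ. RIMS **42** (2006), §3, Theorem 3.7 (iii), author's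
manuscript p. 41 [cite: MochizukiSemiAnbd2006, Thm 3.7(iii) p.41] ("`H` acts continuously on the
semi-graph `𝒢_{∞,i}` … this action factors through a finite quotient … `H` fixes at least one vertex";
"we may assume that there exists a compatible system of vertices of `𝒢_{∞,j}` … each of which is fixed
by `H`").  Cell gap G-t6g3-2 («Thm 3.7 (iii) beyond finite 𝒢»), row E1b (abc-iut-L3-t6).

PROOF-ONLY file (no definitions).  `TemperedCompactFixedSystemsNearest.lean` (E1a) reduced the
hypothesis `hfix` of `VerticialLevelData.compactInVerticial_of_fixedSystems` (abc-iut-L3-t10) for a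
subgroup `C` to a UNIFORM bound: some compatible system `x` stays at bounded distance from the `C`-fixed
vertices.  Here the bound is made ELEMENT-WISE for compact `C`:

* `SemiGraph.exists_dist_nodeMap_eq_two_mul` — ORBIT LEMMA in a tree: if `y ≠ o` is a node fixed by a
  family of automorphisms and nearest to `o` among the fixed nodes, some member of the family moves `o`
  to distance exactly `2·d(o,y)` (the neighbour of `y` towards `o` is not fixed; the two geodesics
  `[y,o]`, `[y,σo]` then only share `y`); so «all displacements `d(o, σ·o) ≤ N`» forces a fixed node within
  distance `N/2` of `o`;
* `VerticialLevelData.exists_fixedSystem_of_displacement_le` — a uniform displacement bound for `C` at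
  every level gives `hfix` (fixed vertices exist at every level by compactness, Lemma 1.8 (ii) —
  `SemiGraph.exists_fixed_vertex_of_isCompact_over`; then the orbit lemma and E1a);
* `VerticialLevelData.exists_fixedSystem_of_pointwise_bdd` — **BAIRE UNIFORMISATION**: for COMPACT `C`
  it suffices that EACH `g ∈ C` has bounded displacement `sup_j d_j(x_j, g·x_j) < ∞`: the displacement is
  locally constant in `g` (open kernels), subadditive and symmetric, so the closed sets
  `{g | ∀ j, d_j ≤ N}` cover the compact Hausdorff (tempered ⇒ `T2`) group `C`, one of them has interior
  (Baire), finitely many translates cover `C`, and subadditivity gives a uniform bound.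

Upshot for G-t6g3-2: the residual `(FIX∞).hfix` for a compact `C ≤ π₁^temp(𝒢)` is EQUIVALENT to the
element-wise statement «every `g ∈ C` is uniformly elliptic along the tower» (E1\*), at every countable
`𝒢`.  Nothing here bears on [IUTchIII] Cor. 3.12.
-/

namespace Literature.AnabelianGeometry.SemiGraphs

open CategoryTheory Topology

universe v u

namespace SemiGraph

variable {G : SemiGraph.{u}}

/-! ### Automorphisms are isometries of the subdivision -/

/-- An automorphism of a connected semi-graph is an isometry of the barycentric subdivision.
[cite: MochizukiSemiAnbd2006, §1 p.11] -/
theorem subdivision_dist_nodeMap (hG : G.IsConnected) (σ : Aut G) (x y : G.Node) :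
    G.subdivision.dist (nodeMap σ x) (nodeMap σ y) = G.subdivision.dist x y := by
  refine le_antisymm (G.subdivision_dist_map_le hG σ.hom x y) ?_
  have h := G.subdivision_dist_map_le hG σ.inv (nodeMap σ x) (nodeMap σ y)
  have hx : Sum.map σ.inv.vertexMap (Sum.map σ.inv.edgeMap σ.inv.branchMap) (nodeMap σ x) = x :=
    nodeMap_symm_nodeMap σ x
  have hy : Sum.map σ.inv.vertexMap (Sum.map σ.inv.edgeMap σ.inv.branchMap) (nodeMap σ y) = y :=
    nodeMap_symm_nodeMap σ y
  rw [hx, hy] at h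
  exact h

/-! ### Geodesics in a tree -/

section Tree

variable {V : Type*} {S : SimpleGraph V}

/-- In a tree every path realises the distance between its end-points. [folklore] -/
private theorem length_eq_dist_of_isPath (hS : S.IsTree) {u v : V} (p : S.Walk u v) (hp : p.IsPath) :
    p.length = S.dist u v := by
  obtain ⟨q, hq, hql⟩ := (hS.1 u v).exists_path_of_dist
  have h := hS.2.path_unique ⟨p, hp⟩ ⟨q, hq⟩
  rw [← hql, ← show q = p from (congrArg Subtype.val h).symm]

/-- Along a geodesic walk, the distance from the start to a node of the walk is the length of the
initial segment up to that node. [folklore] -/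
private theorem dist_eq_length_takeUntil [DecidableEq V] (hconn : S.Connected) {y o : V} (q : S.Walk y o)
    (hq : q.length = S.dist y o) {z : V} (hz : z ∈ q.support) :
    S.dist y z = (q.takeUntil z hz).length := by
  refine le_antisymm (SimpleGraph.dist_le _) ?_
  have h1 : S.dist y o ≤ S.dist y z + S.dist z o := hconn.dist_triangle
  have h2 : S.dist z o ≤ (q.dropUntil z hz).length := SimpleGraph.dist_le _
  have h3 : (q.takeUntil z hz).length + (q.dropUntil z hz).length = q.length := by
    rw [← SimpleGraph.Walk.length_append, q.take_spec hz]
  omega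

end Tree

/-- **Orbit lemma.**  In a tree, let `y ≠ o` be a node fixed by every member of a family `ρ` of
automorphisms and nearest to `o` among such nodes.  Then some member of the family moves `o` to distance
EXACTLY `2·d(o, y)`: the neighbour `a` of `y` on the geodesic towards `o` is not fixed by some `ρ i`, and
then the geodesics `[y, o]` and `[y, ρ i·o] = ρ i·[y, o]` meet only in `y` (a common node `z ≠ y` would be
fixed by `ρ i`, hence so would the segment `[y, z] ∋ a`), so their concatenation is the geodesic from `o`
to `ρ i·o`. (Serre, *Trees*, I §6.4.) [cite: MochizukiSemiAnbd2006, Lem. 1.8 p.20] -/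
theorem exists_dist_nodeMap_eq_two_mul (hG : G.IsTree) {ι : Type*} (ρ : ι → Aut G) (o : G.Node)
    {y : G.Node} (hy : ∀ i, nodeMap (ρ i) y = y)
    (hmin : ∀ z, (∀ i, nodeMap (ρ i) z = z) → G.subdivision.dist o y ≤ G.subdivision.dist o z)
    (hyo : y ≠ o) :
    ∃ i, G.subdivision.dist o (nodeMap (ρ i) o) = 2 * G.subdivision.dist o y := by
  classical
  have hT := hG.isTree
  -- the geodesic from `y` to `o` and its second node `a`, not fixed by some `ρ i`
  obtain ⟨q, hq⟩ := hT.1.exists_walk_length_eq_dist y o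
  have hqp : q.IsPath := q.isPath_of_length_eq_dist hq
  have hqnil : ¬ q.Nil := SimpleGraph.Walk.not_nil_of_ne hyo
  have hlt : G.subdivision.dist o q.snd < G.subdivision.dist o y := by
    have h1 : G.subdivision.dist o q.snd ≤ q.tail.length := by
      have := SimpleGraph.dist_le q.tail.reverse
      rwa [SimpleGraph.Walk.length_reverse] at this
    have h2 : q.tail.length + 1 = q.length := q.length_tail_add_one hqnil
    rw [SimpleGraph.dist_comm] at hq
    omega
  have hna : ∃ i, nodeMap (ρ i) q.snd ≠ q.snd := by
    by_contra h
    have h' : ∀ i, nodeMap (ρ i) q.snd = q.snd := fun i => by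
      by_contra hi
      exact h ⟨i, hi⟩
    exact absurd (hmin _ h') (not_le.mpr hlt)
  obtain ⟨i, hi⟩ := hna
  refine ⟨i, ?_⟩
  -- the graph endomorphism of `ρ i` and the concatenated walk `o — y — ρ i·o`
  let f : G.subdivision →g G.subdivision :=
    { toFun := nodeMap (ρ i), map_rel' := fun h => subdivision_adj_nodeMap (ρ i) h }
  have hf : Function.Injective f := nodeMap_injective (ρ i)
  let q' : G.subdivision.Walk y (nodeMap (ρ i) o) := (q.map f).copy (hy i) rfl
  let W : G.subdivision.Walk o (nodeMap (ρ i) o) := q.reverse.append q'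
  have hWlen : W.length = 2 * G.subdivision.dist o y := by
    simp only [W, q', SimpleGraph.Walk.length_append, SimpleGraph.Walk.length_reverse,
      SimpleGraph.Walk.length_copy, SimpleGraph.Walk.length_map, hq, SimpleGraph.dist_comm]
    ring
  -- `W` is a path: the supports of `[y,o]` and `ρ i·[y,o]` only share `y`
  have hWp : W.IsPath := by
    rw [SimpleGraph.Walk.isPath_def, SimpleGraph.Walk.support_append, List.nodup_append']
    refine ⟨?_, ?_, ?_⟩
    · simpa [SimpleGraph.Walk.support_reverse] using (SimpleGraph.Walk.isPath_def _).mp hqp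
    · have hq'p : q'.IsPath := by
        simp only [q', SimpleGraph.Walk.isPath_copy]
        exact hqp.map hf
      have := (SimpleGraph.Walk.isPath_def _).mp hq'p
      exact this.sublist (List.tail_sublist _)
    · intro z hz1 hz2
      rw [SimpleGraph.Walk.support_reverse, List.mem_reverse] at hz1
      have hq'supp : q'.support = q.support.map f := by
        simp only [q', SimpleGraph.Walk.support_copy, SimpleGraph.Walk.support_map]
      rw [hq'supp, ← List.map_tail] at hz2
      obtain ⟨w, hw, hwz⟩ := List.mem_map.mp hz2
      have hwsupp : w ∈ q.support := List.mem_of_mem_tail hw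
      have hwy : w ≠ y := by
        intro hwy
        have hnd := (SimpleGraph.Walk.isPath_def _).mp hqp
        rw [← SimpleGraph.Walk.cons_tail_support] at hnd
        exact (List.nodup_cons.mp hnd).1 (hwy ▸ hw)
      -- `d(y, z) = d(y, w)` by the isometry, so `z = w` on the geodesic
      have hdist : G.subdivision.dist y z = G.subdivision.dist y w := by
        have := G.subdivision_dist_nodeMap ⟨hT.1⟩ (ρ i) y w
        rw [hy i] at this
        rw [← hwz]
        exact this
      have hkz := dist_eq_length_takeUntil hT.1 q hq hz1
      have hkw := dist_eq_length_takeUntil hT.1 q hq hwsupp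
      have hzw : z = w := by
        have h1 := q.getVert_length_takeUntil hz1
        have h2 := q.getVert_length_takeUntil hwsupp
        rw [← hkz] at h1
        rw [← hkw, ← hdist] at h2
        exact h1.symm.trans h2
      -- hence `ρ i` fixes `z ≠ y`, so it fixes `[y, z] ∋ a`: contradiction
      have hfz : nodeMap (ρ i) z = z := by rw [hzw] at hwz ⊢; exact hwz
      have hzy : z ≠ y := hzw ▸ hwy
      have hfix := nodeMap_eq_self_of_isPath hT.2 (ρ i) (hy i) hfz (q.takeUntil z hz1)
        (hqp.takeUntil hz1)
      have hsnd : (q.takeUntil z hz1).snd = q.snd := q.snd_takeUntil hzy hz1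
      have hmem : (q.takeUntil z hz1).snd ∈ (q.takeUntil z hz1).support :=
        SimpleGraph.Walk.getVert_mem_support _ 1
      exact hi (hsnd ▸ hfix _ hmem)
  rw [← hWlen]
  exact (length_eq_dist_of_isPath hT W hWp).symm

end SemiGraph

namespace ProfiniteSemiGraph

namespace VerticialLevelData

variable {𝒢 : ProfiniteSemiGraph.{u}} {c : TemperedPiChart 𝒢} (D : VerticialLevelData.{v} 𝒢 c)

/-- The action on nodes is multiplicative (for the displacement calculus). [cite: MochizukiSemiAnbd2006, Thm 3.7(iii) p.41] -/
theorem nodeMap_act_mul (j : D.J) (g h : c.G) (z : (D.tree j).Node) :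
    SemiGraph.nodeMap (D.act j (g * h)) z = SemiGraph.nodeMap (D.act j g) (SemiGraph.nodeMap (D.act j h) z) := by
  rw [map_mul, SemiGraph.nodeMap_mul]

/-- **`hfix` from a UNIFORM displacement bound** ([SemiAnbd] Thm 3.7 (iii) p. 41, finiteness-free): if
`C` is compact and every `g ∈ C` moves each `x_j` by at most `N` in the subdivision of `D.tree j`, then
`C` fixes a compatible vertex system: at each level `C` fixes some vertex (it acts through a finite
quotient on a tree, over the base — Lemma 1.8 (ii), `SemiGraph.exists_fixed_vertex_of_isCompact_over`),
the nearest fixed node to `x_j` is a vertex within distance `N` (orbit lemma), and E1a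
(`exists_fixedSystem_of_bddDist`) applies. [cite: MochizukiSemiAnbd2006, Thm 3.7(iii) p.41] -/
theorem exists_fixedSystem_of_displacement_le (C : Subgroup c.G) (hC : IsCompact (C : Set c.G))
    (x : ∀ j, (D.tree j).Vertex) (hx : ∀ ⦃i j : D.J⦄ (h : i ≤ j), (D.trans h).vertexMap (x j) = x i)
    (N : ℕ) (hN : ∀ g ∈ C, ∀ j, (D.tree j).subdivision.dist (Sum.inl (x j))
      (Sum.inl ((D.act j g).hom.vertexMap (x j))) ≤ N) :
    ∃ y : ∀ j, (D.tree j).Vertex, (∀ ⦃i j : D.J⦄ (h : i ≤ j), (D.trans h).vertexMap (y j) = y i) ∧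
      ∀ g ∈ C, ∀ j, (D.act j g).hom.vertexMap (y j) = y j := by
  classical
  refine D.exists_fixedSystem_of_bddDist C x hx N fun j => ?_
  -- fixed nodes at level `j` (indexed by `↥C`) and the nearest one to `x j`
  let Fx : (D.tree j).Node → Prop := fun z => ∀ g : C, SemiGraph.nodeMap (D.act j g) z = z
  have hFx_vert : ∀ (y : (D.tree j).Vertex),
      Fx (Sum.inl y) ↔ ∀ g ∈ C, (D.act j g).hom.vertexMap y = y := fun y => by
    simp only [Fx, SemiGraph.nodeMap, Sum.map_inl, Sum.inl.injEq, Subtype.forall]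
  obtain ⟨v, hv⟩ := SemiGraph.exists_fixed_vertex_of_isCompact_over C hC (D.isTree j) (D.vertex j)
    (D.proj j) (D.act j) (D.isOpen_ker j) (D.act_over j)
  have hex : ∃ n, ∃ z, Fx z ∧ (D.tree j).subdivision.dist (Sum.inl (x j)) z = n :=
    ⟨_, Sum.inl v, fun g => by simpa [SemiGraph.nodeMap] using hv g, rfl⟩
  obtain ⟨z, hz, hzd⟩ := Nat.find_spec hex
  have hmin : ∀ w, Fx w → (D.tree j).subdivision.dist (Sum.inl (x j)) z ≤
      (D.tree j).subdivision.dist (Sum.inl (x j)) w := fun w hw => by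
    rw [hzd]; exact Nat.find_min' hex ⟨w, hw, rfl⟩
  -- it is a vertex node …
  obtain ⟨w, rfl⟩ := SemiGraph.isNearest_fixed_is_vertex (D.isTree j) (D.proj j)
    (fun g : C => D.act j g) (fun g => D.act_over j g) (x j) hz hmin
  refine ⟨w, (hFx_vert w).mp hz, ?_⟩
  -- … within distance `N` (orbit lemma, or distance `0`)
  by_cases hwo : (Sum.inl w : (D.tree j).Node) = Sum.inl (x j)
  · rw [hwo, SimpleGraph.dist_self]; exact Nat.zero_le _
  obtain ⟨g, hg⟩ := SemiGraph.exists_dist_nodeMap_eq_two_mul (D.isTree j) (fun g : C => D.act j g)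
    (Sum.inl (x j)) hz hmin hwo
  have hgN := hN g g.2 j
  have : SemiGraph.nodeMap (D.act j g) (Sum.inl (x j)) = Sum.inl ((D.act j g).hom.vertexMap (x j)) := by
    simp [SemiGraph.nodeMap]
  rw [this] at hg
  omega

/-- **`hfix` from POINTWISE bounded displacement — Baire uniformisation** ([SemiAnbd] Thm 3.7 (iii)
p. 41, finiteness-free; cell gap G-t6g3-2, row E1b): for a COMPACT subgroup `C` of the (tempered, hence
Hausdorff) chart group and a compatible vertex system `x`, if every single `g ∈ C` has bounded
displacement `sup_j d_j(x_j, g·x_j) < ∞`, then `C` fixes a compatible vertex system.  The displacement is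
locally constant in `g` (the actions have open kernels), subadditive (`d(o, gh·o) ≤ d(o, g·o) + d(o, h·o)`,
isometric action) and symmetric; the closed sets `F_N = {g ∈ C | ∀ j, d_j(x_j, g·x_j) ≤ N}` cover the
compact Hausdorff space `C`, so one `F_N` has nonempty interior (Baire); finitely many left translates of
it cover `C` (compactness), and subadditivity bounds the displacement uniformly; conclude by
`exists_fixedSystem_of_displacement_le`.  So the hypothesis `hfix` of
`compactInVerticial_of_fixedSystems` holds for `C` as soon as each ELEMENT of `C` is uniformly elliptic
along the tower. [cite: MochizukiSemiAnbd2006, Thm 3.7(iii) p.41] -/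
theorem exists_fixedSystem_of_pointwise_bdd (C : Subgroup c.G) (hC : IsCompact (C : Set c.G))
    (x : ∀ j, (D.tree j).Vertex) (hx : ∀ ⦃i j : D.J⦄ (h : i ≤ j), (D.trans h).vertexMap (x j) = x i)
    (hpt : ∀ g ∈ C, ∃ N : ℕ, ∀ j, (D.tree j).subdivision.dist (Sum.inl (x j))
      (Sum.inl ((D.act j g).hom.vertexMap (x j))) ≤ N) :
    ∃ y : ∀ j, (D.tree j).Vertex, (∀ ⦃i j : D.J⦄ (h : i ≤ j), (D.trans h).vertexMap (y j) = y i) ∧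
      ∀ g ∈ C, ∀ j, (D.act j g).hom.vertexMap (y j) = y j := by
  classical
  haveI : T2Space c.G := c.isTempered.t2Space
  haveI : CompactSpace C := isCompact_iff_compactSpace.mp hC
  -- displacement of `g` at level `j`
  let φ : D.J → C → ℕ := fun j g =>
    (D.tree j).subdivision.dist (Sum.inl (x j)) (Sum.inl ((D.act j g).hom.vertexMap (x j)))
  have hφ_node : ∀ j (g : C), φ j g =
      (D.tree j).subdivision.dist (Sum.inl (x j)) (SemiGraph.nodeMap (D.act j g) (Sum.inl (x j))) :=
    fun j g => by simp [φ, SemiGraph.nodeMap]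
  -- subadditive and symmetric
  have hconn : ∀ j, (D.tree j).IsConnected := fun j => ⟨(D.isTree j).isTree.1⟩
  have hφ_mul : ∀ j (g h : C), φ j (g * h) ≤ φ j g + φ j h := by
    intro j g h
    rw [hφ_node, hφ_node, hφ_node, Subgroup.coe_mul, D.nodeMap_act_mul]
    calc (D.tree j).subdivision.dist (Sum.inl (x j))
          (SemiGraph.nodeMap (D.act j g) (SemiGraph.nodeMap (D.act j h) (Sum.inl (x j))))
        ≤ (D.tree j).subdivision.dist (Sum.inl (x j)) (SemiGraph.nodeMap (D.act j g) (Sum.inl (x j))) +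
          (D.tree j).subdivision.dist (SemiGraph.nodeMap (D.act j g) (Sum.inl (x j)))
            (SemiGraph.nodeMap (D.act j g) (SemiGraph.nodeMap (D.act j h) (Sum.inl (x j)))) :=
          (hconn j).connected.dist_triangle
      _ = _ := by rw [SemiGraph.subdivision_dist_nodeMap (hconn j)]
  -- saturation: conditions on `D.act j g` cut out OPEN subsets of `C` (open kernels)
  have hopenQ : ∀ j (Q : Aut (D.tree j) → Prop), IsOpen {g : C | Q (D.act j (g : c.G))} := by
    intro j Q
    refine isOpen_iff_forall_mem_open.mpr fun g hg => ?_
    refine ⟨{h : C | D.act j (h : c.G) = D.act j (g : c.G)}, fun h hh => ?_, ?_, rfl⟩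
    · show Q (D.act j (h : c.G))
      rw [show D.act j (h : c.G) = D.act j (g : c.G) from hh]
      exact hg
    · have hopen : IsOpen {h : c.G | D.act j h = D.act j g} := by
        have : {h : c.G | D.act j h = D.act j g} =
            (fun h => (g : c.G)⁻¹ * h) ⁻¹' ((D.act j).ker : Set c.G) := by
          ext h
          simp only [Set.mem_setOf_eq, Set.mem_preimage, SetLike.mem_coe, MonoidHom.mem_ker, map_mul,
            map_inv]
          constructor
          · intro hh; rw [hh, inv_mul_cancel]
          · intro hh; exact (inv_mul_eq_one.mp hh).symm
        rw [this]
        exact (D.isOpen_ker j).preimage (continuous_const.mul continuous_id)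
      exact hopen.preimage continuous_subtype_val
  -- the closed sets `F N`, covering `C`
  let F : ℕ → Set C := fun N => {g | ∀ j, φ j g ≤ N}
  have hF_closed : ∀ N, IsClosed (F N) := fun N => by
    have : F N = ⋂ j, {g : C | φ j g ≤ N} := by ext g; simp [F]
    rw [this]
    refine isClosed_iInter fun j => ⟨?_⟩
    have := hopenQ j (fun σ => ¬ (D.tree j).subdivision.dist (Sum.inl (x j))
      (Sum.inl (σ.hom.vertexMap (x j))) ≤ N)
    exact this
  have hF_cover : ⋃ N, F N = Set.univ := by
    refine Set.eq_univ_of_forall fun g => ?_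
    obtain ⟨N, hN⟩ := hpt g g.2
    exact Set.mem_iUnion.mpr ⟨N, fun j => hN j⟩
  -- Baire: some `F N₀` has interior
  obtain ⟨N₀, hN₀⟩ := nonempty_interior_of_iUnion_of_closed hF_closed hF_cover
  -- cover `C` by finitely many left translates of `F N₀` (compactness)
  obtain ⟨t, ht⟩ := compact_covered_by_mul_left_translates (isCompact_univ (X := C)) hN₀
  -- pointwise bounds for the finitely many elements `g⁻¹`, `g ∈ t`
  choose Np hNp using fun g : C => hpt g g.2
  let B : ℕ := N₀ + t.sup fun g => Np g⁻¹
  refine D.exists_fixedSystem_of_displacement_le C hC x hx B fun g' hg' j => ?_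
  -- uniform bound at `g'`: `g' = g⁻¹ · (g g')` with `g g' ∈ F N₀`
  obtain ⟨g, hgt, hgg'⟩ := Set.mem_iUnion₂.mp (ht (Set.mem_univ (⟨g', hg'⟩ : C)))
  have hmem : g * ⟨g', hg'⟩ ∈ F N₀ := hgg'
  have h1 : φ j (⟨g', hg'⟩ : C) ≤ φ j g⁻¹ + φ j (g * ⟨g', hg'⟩) := by
    have := hφ_mul j g⁻¹ (g * ⟨g', hg'⟩)
    rwa [inv_mul_cancel_left] at this
  have h2 : φ j g⁻¹ ≤ t.sup fun g => Np g⁻¹ :=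
    (hNp _ j).trans (Finset.le_sup (f := fun g => Np g⁻¹) hgt)
  have h3 : φ j (g * ⟨g', hg'⟩) ≤ N₀ := hmem j
  show φ j ⟨g', hg'⟩ ≤ B
  simp only [B]
  omega

end VerticialLevelData

end ProfiniteSemiGraph

end Literature.AnabelianGeometry.SemiGraphs
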